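import Summits.QuantumAdvantage.QuantumAdvantage.Theorems.CubicForrelationNearExactIsExactTwelveTypeOWindow
import Summits.QuantumAdvantage.QuantumAdvantage.Theorems.CubicForrelationNearExactIsExactSecondWeightAll
import Summits.QuantumAdvantage.QuantumAdvantage.Theorems.CubicForrelationNearExactIsExactTypeE8

/-!
# Crux `CubicForrelation.NearExactIsExact` (stmt-QuantumAdvantage-14043) — n = 12: a TYPE-O side is impossible for `Φ ≥ 59/64`
  (the boundary case `Φ = 59/64` of `to12_typeO_le`)

Certificate seat `b2b-cforr-cert` (gen 15).  HONEST FRAMING: a kernel-checked THEOREM (standard axioms) about cubic Boolean pairs on 12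
bits — the type-O branch of "is `59/64` attained at `n = 12`?" (tree: `θ₁₂ ∈ [57/64, 59/64]`).  Finite-slice statement; NOT summit progress.

THEOREM `to15_typeO_ge_false`: cubic `f, g : 𝔽₂¹² → 𝔽₂` with `W_g = 16u`, some `u(x)` odd (type O) and `Φ(f,g) ≥ 59/64` do not exist
(the tree's `to12_typeO_le` gives `Φ ≤ 59/64`; here the equality `Φ = 59/64` is excluded).  Proof at `Φ = 59/64` (`τ = u − 4s`, `Σ τ² = 2¹⁷(1 − Φ) = 10240`; digits `d₁` affine, `d₂` cubic, `E = {d₁ = d₂}` = support of a cubic,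
base pattern `τ₀ = (−1)^{d₁}(1 − 4·1_E)`, `τ = τ₀ + 8v`, `Σ τ₀² = 4096 + 8#E`, excess `X = τ² − τ₀² ≥ 0`): `#E ≤ 768`.
* `#E < 768` ⇒ `#E = 512` (second weight), excess budget `2048`; gen 12's relative tower (`to12_cube_congr`, `to12_level`, `to12_excess`)
  still kills every wild point (`256·16`, `64·160`, `8·832`, `3712` all exceed `2048`), so `Σ τ² = 8192 ≠ 10240`.
* `#E = 768` (NEW): the excess is `0`, so `v ≡ 0` and `u = 4(−1)^f + τ₀` EXACTLY.  Walsh inversion then gives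
  `W_f(y) = 64(−1)^{g(y)} ∓ 1024·[y = c₁] ± Σ_{x ∈ E} (−1)^{x·(c₁ ⊕ y)}` (`(−1)^{d₁} = ±(−1)^{c₁·x}`), and the character sum over `E` is a
  multiple of `256`: by the second weight of `RM(4,12)` (`sw_second_weight_all`, `r = 4`) applied to the two quartics `1_E·1_{H}`, `1_E·1_{H^c}`
  (`H` the hyperplane of the character) the half weights `#(E ∩ H)` lie in `{0, 256, 384, 512, 768}` (`to15_halfweight`).  Hence
  `W_f ≡ 64(−1)^g (mod 256)`, `W_f(y)² = 4096(±1 + 4M)² ≥ 4096`, and Parseval forces `W_f = 64(−1)^g`, i.e. `Φ = 1` — not `59/64`.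

References: Ax (1964) / McEliece (1972); Kasami–Tokura (1970); MacWilliams–Sloane (1977) Ch. 13–15; O'Donnell (2014) §3.3.  Axioms: standard.
-/

set_option linter.dupNamespace false -- D-0017: single-problem summit ⇒ `QuantumAdvantage.QuantumAdvantage` by design

noncomputable section

namespace Summit.QuantumAdvantage.QuantumAdvantage.Theorems.CubicForrelation.NearExactIsExact

open Finset
open Literature.Computability.QuantumComplexity
open Literature.Computability.QuantumComplexity.BuzetChailloux (bxor zeroVec bxor_bxor_cancel_left bxor_zeroVec zeroVec_bxor bxor_comm
  bxor_self twist_zeroVec_right twist_bxor_right signOf_sq)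
open Literature.Computability.QuantumComplexity.DerivativeWalsh (W sum_W_sq)
open Summit.QuantumAdvantage.QuantumAdvantage.Theorems.NearExactIsExact.Negative (TypeOTwelve.no_caseA TypeOTwelve.cube_sum_dvd
  TypeOTwelve.typeO_of_exists_odd)
open Summit.QuantumAdvantage.QuantumAdvantage.Theorems.SignedCubicForrelationNotPrBPP (knf_isDegLeFun_ip)

/-! ### Half weights of a weight-768 cubic support -/

/-- **Half weights of a cubic of weight `768` on 12 bits.**  If `c` is cubic with `#{c = 1} = 768` and `ℓ` is affine, then
`#{c = 1, ℓ = 1} ∈ {0, 256, 384, 512, 768}`: both `c·ℓ` and `c·(ℓ ⊕ 1)` have degree `≤ 4`, and a degree-`4` function on 12 bits with fewer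
than `384` ones has `0` or `256` of them (second weight of `RM(4,12)`, `sw_second_weight_all`). [this work] -/
theorem to15_halfweight (c ℓ : (Fin (6 + 6) → Bool) → Bool) (hc : IsDegLeFun 3 c) (hℓ : IsDegLeFun 1 ℓ)
    (h768 : #(univ.filter fun x => c x = true) = 768) :
    #(univ.filter fun x => (c x && ℓ x) = true) = 0 ∨ #(univ.filter fun x => (c x && ℓ x) = true) = 256 ∨
    #(univ.filter fun x => (c x && ℓ x) = true) = 384 ∨ #(univ.filter fun x => (c x && ℓ x) = true) = 512 ∨
    #(univ.filter fun x => (c x && ℓ x) = true) = 768 := by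
  classical
  set A := univ.filter (fun x : Fin (6 + 6) → Bool => (c x && ℓ x) = true) with hAdef
  set B := univ.filter (fun x : Fin (6 + 6) → Bool => (c x && (ℓ x ^^ true)) = true) with hBdef
  have hAB : #A + #B = 768 := by
    have eA : A = (univ.filter fun x : Fin (6 + 6) → Bool => c x = true).filter (fun x => ℓ x = true) := by
      ext x; simp only [hAdef, mem_filter, mem_univ, true_and]; cases c x <;> cases ℓ x <;> simp
    have eB : B = (univ.filter fun x : Fin (6 + 6) → Bool => c x = true).filter (fun x => ¬ ℓ x = true) := by
      ext x; simp only [hBdef, mem_filter, mem_univ, true_and]; cases c x <;> cases ℓ x <;> simp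
    rw [eA, eB, card_filter_add_card_filter_not, h768]
  have hdegA : IsDegLeFun (3 + 1) (fun x => c x && ℓ x) := te_isDegLeFun_band hc hℓ
  have hdegB : IsDegLeFun (3 + 1) (fun x => c x && (ℓ x ^^ true)) := te_isDegLeFun_band hc (tb_isDegLeFun_xor_const hℓ true)
  have hsmall : ∀ (e : (Fin (6 + 6) → Bool) → Bool), IsDegLeFun (3 + 1) e → #(univ.filter fun x => e x = true) < 384 →
      #(univ.filter fun x => e x = true) = 0 ∨ #(univ.filter fun x => e x = true) = 256 := by
    intro e he hlt
    by_cases hne : ∃ x, e x = true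
    · right
      have h := sw_second_weight_all 4 (by norm_num) (6 + 6) e he hne (by norm_num; omega)
      norm_num at h
      omega
    · left
      push Not at hne
      exact card_eq_zero.2 (filter_eq_empty_iff.2 fun x _ => by simp [hne x])
  have hA := hsmall _ hdegA
  have hB := hsmall _ hdegB
  change #A < 384 → #A = 0 ∨ #A = 256 at hA
  change #B < 384 → #B = 0 ∨ #B = 256 at hB
  show #A = 0 ∨ #A = 256 ∨ #A = 384 ∨ #A = 512 ∨ #A = 768
  omega

/-- **Character sums over a weight-768 cubic support are multiples of `256`**: `Σ_{x : c(x)=1} (−1)^{x·z} ∈ 256ℤ` for every `z`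
(the sum is `768 − 2·#{c = 1, x·z odd}` and `to15_halfweight`). [this work] -/
theorem to15_char_sum_E (c : (Fin (6 + 6) → Bool) → Bool) (hc : IsDegLeFun 3 c) (h768 : #(univ.filter fun x => c x = true) = 768)
    (z : Fin (6 + 6) → Bool) :
    ∃ m : ℤ, ∑ x ∈ univ.filter (fun x => c x = true), twist x z = 256 * (m : ℝ) := by
  classical
  set ℓ : (Fin (6 + 6) → Bool) → Bool := fun x => decide (Odd #(univ.filter fun i => x i && z i)) with hℓdef
  have hℓ : IsDegLeFun 1 ℓ := knf_isDegLeFun_ip z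
  have htw : ∀ x, twist x z = 1 - 2 * (if ℓ x = true then (1 : ℝ) else 0) := by
    intro x
    rw [vg_twist_eq_signOf x z]
    change signOf (ℓ x) = 1 - 2 * (if ℓ x = true then (1 : ℝ) else 0)
    unfold signOf
    cases ℓ x <;> norm_num
  have hsum : ∑ x ∈ univ.filter (fun x => c x = true), twist x z =
      768 - 2 * (#(univ.filter fun x => (c x && ℓ x) = true) : ℝ) := by
    rw [sum_congr rfl fun x _ => htw x, sum_sub_distrib, sum_const, h768, ← mul_sum, sum_boole]
    have e : (univ.filter fun x : Fin (6 + 6) → Bool => c x = true).filter (fun x => ℓ x = true) =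
        univ.filter fun x => (c x && ℓ x) = true := by
      ext x; simp only [mem_filter, mem_univ, true_and]; cases c x <;> cases ℓ x <;> simp
    rw [e]; norm_num
  rw [hsum]
  rcases to15_halfweight c ℓ hc hℓ h768 with h | h | h | h | h <;> rw [h]
  · exact ⟨3, by norm_num⟩
  · exact ⟨1, by norm_num⟩
  · exact ⟨0, by norm_num⟩
  · exact ⟨-1, by norm_num⟩
  · exact ⟨-3, by norm_num⟩

/-! ### The theorem -/

/-- **A type-O side is impossible for `Φ ≥ 59/64` on 12 bits.**  Cubic `f, g : 𝔽₂¹² → 𝔽₂` with `W_g = 16u`, some `u(x)` odd and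
`Φ(f,g) ≥ 59/64` cannot exist (`Φ > 59/64`: `to12_typeO_le`; `Φ = 59/64`: `#E = 512` by gen 12's tower, `#E = 768` forces an exact base
pattern whose partner spectrum is `≡ 64(−1)^g (mod 256)`, hence bent with dual `g`, `Φ = 1`).  Finite-slice statement; NOT summit
progress. [this work] -/
theorem to15_typeO_ge_false (f g : (Fin (6 + 6) → Bool) → Bool) (hf : IsDegLeFun 3 f) (hg : IsDegLeFun 3 g)
    (u : (Fin (6 + 6) → Bool) → ℤ) (hu : ∀ x, W (fun y => signOf (g y)) x = (2 : ℝ) ^ 4 * (u x : ℝ))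
    (hodd : ∃ x, Odd (u x)) (hΦ : (59 / 64 : ℝ) ≤ forrelation f g) : False := by
  classical
  have hΦeq : forrelation f g = 59 / 64 := le_antisymm (to12_typeO_le f g hf hg u hu hodd) hΦ
  have hall : ∀ x, Odd (u x) := TypeOTwelve.typeO_of_exists_odd g u hg hu hodd
  have hu' : ∀ x, W (fun y => signOf (g y)) x = (2 : ℝ) ^ (2 * 2) * (u x : ℝ) := fun x => (hu x).trans (by norm_num)
  have hd1 : IsDegLeFun 1 (fun x => decide (Odd (u x / 2))) := z2_digitOne 2 g u hg hu' hall
  have hd2 : IsDegLeFun 3 (fun x => decide (Odd (u x / 2 / 2))) := z2_digitTwo 2 g u hg hu' hall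
  -- case A (all `u ≡ ±3 (mod 8)`) is empty
  have hnoA : ¬ (∀ x, ¬ (Odd (u x / 2) ↔ Odd (u x / 2 / 2))) := by
    intro h
    refine TypeOTwelve.no_caseA g u hg hu fun x => ?_
    have h0 := Int.odd_iff.1 (hall x)
    have hx := h x
    rw [Int.odd_iff, Int.odd_iff] at hx
    omega
  set E := univ.filter (fun x : Fin (6 + 6) → Bool => (Odd (u x / 2) ↔ Odd (u x / 2 / 2))) with hEdef
  have hmemE : ∀ x, x ∈ E ↔ (Odd (u x / 2) ↔ Odd (u x / 2 / 2)) := fun x => by simp [hEdef]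
  have hdegE : IsDegLeFun (2 + 1) (fun x => (decide (Odd (u x / 2)) ^^ decide (Odd (u x / 2 / 2))) ^^ true) :=
    tb_isDegLeFun_xor_const (bb_isDegLeFun_bxor (hd1.mono (by norm_num)) hd2) true
  have hsetE : (univ.filter fun x : Fin (6 + 6) → Bool =>
      ((decide (Odd (u x / 2)) ^^ decide (Odd (u x / 2 / 2))) ^^ true) = true) = E := by
    rw [hEdef]
    apply filter_congr
    intro x _
    by_cases h1 : Odd (u x / 2) <;> by_cases h2 : Odd (u x / 2 / 2) <;> simp [h1, h2]
  have hne : ∃ x, ((decide (Odd (u x / 2)) ^^ decide (Odd (u x / 2 / 2))) ^^ true) = true := by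
    by_contra hnone
    push Not at hnone
    refine hnoA fun x => ?_
    have hx := hnone x
    by_cases h1 : Odd (u x / 2) <;> by_cases h2 : Odd (u x / 2 / 2) <;> simp [h1, h2] at hx ⊢
  have hsumE : (∑ x, (if (Odd (u x / 2) ↔ Odd (u x / 2 / 2)) then 1 else 0 : ℤ)) = #E := by rw [sum_boole]
  -- budget `Σ τ² = 2¹⁷(1 − Φ) = 10240`
  have hbud := tw12_budget f g u hu
  have hT : (∑ x, (u x - 4 * sZ (f x)) ^ 2 : ℤ) = 10240 := by
    have h' : ((∑ x, (u x - 4 * sZ (f x)) ^ 2 : ℤ) : ℝ) = 10240 := by rw [hbud, hΦeq]; norm_num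
    exact_mod_cast h'
  -- base pattern `τ₀` and wild function `v`: `τ = τ₀ + 8v`
  choose v hv using fun x => to12_pt_mod8 (u x) (sZ (f x)) (hall x) (tp_sZ_cases (f x))
  set τ₀ : (Fin (6 + 6) → Bool) → ℤ := fun x =>
    sZ (decide (Odd (u x / 2))) * (1 - 4 * (if (Odd (u x / 2) ↔ Odd (u x / 2 / 2)) then 1 else 0)) with hτ₀def
  have hvx : ∀ x, u x - 4 * sZ (f x) = τ₀ x + 8 * v x := fun x => hv x
  have hτ₀val : ∀ x, τ₀ x = 1 ∨ τ₀ x = -1 ∨ τ₀ x = 3 ∨ τ₀ x = -3 := by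
    intro x
    simp only [τ₀]
    rcases tp_sZ_cases (decide (Odd (u x / 2))) with h | h <;> rw [h] <;> split_ifs <;> norm_num
  have hτ₀sq : ∀ x, τ₀ x ^ 2 = 1 + 8 * (if (Odd (u x / 2) ↔ Odd (u x / 2 / 2)) then 1 else 0 : ℤ) := by
    intro x
    simp only [τ₀]
    rcases tp_sZ_cases (decide (Odd (u x / 2))) with h | h <;> rw [h] <;> split_ifs <;> norm_num
  have hsumτ₀ : ∑ x, τ₀ x ^ 2 = 4096 + 8 * #E := by
    rw [sum_congr rfl fun x _ => hτ₀sq x, sum_add_distrib, ← mul_sum, hsumE, sum_const, card_univ, Fintype.card_fun,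
      Fintype.card_bool, Fintype.card_fin]
    norm_num
  -- excess decomposition `Σ τ² = Σ τ₀² + Σ X`, `X ≥ 0`
  set X : (Fin (6 + 6) → Bool) → ℤ := fun x => (τ₀ x + 8 * v x) ^ 2 - τ₀ x ^ 2 with hXdef
  have hXnn : ∀ x, 0 ≤ X x := fun x => to12_excess_nonneg _ _ (hτ₀val x)
  have hTdec : (∑ x, (u x - 4 * sZ (f x)) ^ 2 : ℤ) = ∑ x, τ₀ x ^ 2 + ∑ x, X x := by
    rw [← sum_add_distrib]
    exact sum_congr rfl fun x _ => by rw [hvx x]; simp only [X]; ring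
  have hXsum_nn : 0 ≤ ∑ x, X x := sum_nonneg fun x _ => hXnn x
  have hE768 : #E ≤ 768 := by
    have h1 : (4096 : ℤ) + 8 * #E ≤ 10240 := by linarith
    have h2 : (#E : ℤ) ≤ 768 := by linarith
    exact_mod_cast h2
  by_cases hElt : #E < 768
  · /- `#E = 512`: gen 12's tower verbatim, with excess budget `2048` -/
    have hE16 : 16 * #E < 3 * 2 ^ (6 + 6) := by norm_num; omega
    have hE512 : #E = 512 := by
      have h := sw_cubic_second_weight (m := 6 + 6) _ hdegE hne (by rw [hsetE]; exact hE16)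
      rw [hsetE] at h
      norm_num at h
      omega
    have hXsum : ∑ x, X x ≤ 2048 := by
      have : (∑ x, (u x - 4 * sZ (f x)) ^ 2 : ℤ) = 8192 + ∑ x, X x := by rw [hTdec, hsumτ₀, hE512]; norm_num
      linarith
    -- `E` is a 9-flat
    have hmwE := mw_flat_of_minweight 2 _ hdegE (by rw [hsetE, hE512]; norm_num)
    rw [hsetE] at hmwE
    obtain ⟨h0E, haddE, hcardVE, hcosetE⟩ := hmwE
    set VE := univ.filter (fun a : Fin (6 + 6) → Bool => ∀ x,
      ((decide (Odd (u (bxor x a) / 2)) ^^ decide (Odd (u (bxor x a) / 2 / 2))) ^^ true) =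
        ((decide (Odd (u x / 2)) ^^ decide (Odd (u x / 2 / 2))) ^^ true)) with hVE
    rw [hE512] at hcardVE
    have hEpos : 0 < #E := by rw [hE512]; norm_num
    obtain ⟨xE, hxE⟩ : E.Nonempty := card_pos.1 hEpos
    have hSE : E = VE.image (bxor xE) := hcosetE xE (by
      have h := (hmemE xE).1 hxE
      by_cases h1 : Odd (u xE / 2)
      · have h2 : Odd (u xE / 2 / 2) := h.1 h1
        simp [h1, h2]
      · have h2 : ¬ Odd (u xE / 2 / 2) := fun h' => h1 (h.2 h')
        simp [h1, h2])
    -- the wild identity in coset form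
    have hv' : ∀ x, u x - 4 * sZ (f x) =
        sZ (decide (Odd (u x / 2))) * (1 - 4 * (if x ∈ VE.image (bxor xE) then 1 else 0)) + 8 * v x := by
      intro x
      rw [← hSE, hvx x]
      simp only [τ₀]
      by_cases hx : (Odd (u x / 2) ↔ Odd (u x / 2 / 2))
      · rw [if_pos hx, if_pos ((hmemE x).2 hx)]
      · rw [if_neg hx, if_neg (fun h' => hx ((hmemE x).1 h'))]
    have hcc := fun I => to12_cube_congr f g hf hg u hu hd1 VE xE h0E haddE hcardVE v hv' I
    -- excess of a set of wild points
    have hXset : ∀ (S : Finset (Fin (6 + 6) → Bool)) (c : ℤ), 1 ≤ c → (∀ x ∈ S, c ≤ v x ∨ v x ≤ -c) →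
        16 * c * (4 * c - 3) * #S ≤ ∑ x, X x := by
      intro S c hc hS
      calc 16 * c * (4 * c - 3) * #S = ∑ x ∈ S, 16 * c * (4 * c - 3) := by rw [sum_const, nsmul_eq_mul, mul_comm]
        _ ≤ ∑ x ∈ S, X x := sum_le_sum fun x hx => to12_excess _ _ c (hτ₀val x) hc (hS x hx)
        _ ≤ ∑ x, X x := sum_le_sum_of_subset_of_nonneg (subset_univ _) fun x _ _ => hXnn x
    -- LEVEL 1: `v` is even
    have hv2 : ∀ x, Even (v x) := by
      rcases to12_level v 4 (fun I hI => (hcc I).1 (by omega)) with h | h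
      · exact h
      · exfalso
        have hcnt : (256 : ℤ) ≤ #(univ.filter fun x => Odd (v x)) := by norm_num at h; exact_mod_cast (by omega)
        have hge := hXset (univ.filter fun x => Odd (v x)) 1 le_rfl (fun x hx => by
          obtain ⟨k, hk⟩ := (mem_filter.1 hx).2; omega)
        linarith
    choose v₁ hv₁ using hv2
    have hvv₁ : ∀ x, v x = 2 * v₁ x := fun x => by rw [two_mul]; exact hv₁ x
    -- LEVEL 2: `v/2` is even
    have hv4 : ∀ x, Even (v₁ x) := by
      rcases to12_level v₁ 6 (fun I hI => by
        have h4 := (hcc I).2.1 (by omega)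
        rw [sum_congr rfl (fun x _ => hvv₁ x), ← mul_sum] at h4
        omega) with h | h
      · exact h
      · exfalso
        have hcnt : (64 : ℤ) ≤ #(univ.filter fun x => Odd (v₁ x)) := by norm_num at h; exact_mod_cast (by omega)
        have hge := hXset (univ.filter fun x => Odd (v₁ x)) 2 (by norm_num) (fun x hx => by
          obtain ⟨k, hk⟩ := (mem_filter.1 hx).2; have := hvv₁ x; omega)
        linarith
    choose v₂ hv₂ using hv4
    have hvv₂ : ∀ x, v x = 4 * v₂ x := fun x => by rw [hvv₁ x, hv₂ x]; ring
    -- LEVEL 3: `v/4` is even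
    have hv8 : ∀ x, Even (v₂ x) := by
      rcases to12_level v₂ 9 (fun I hI => by
        have h8 := (hcc I).2.2 (by omega)
        rw [sum_congr rfl (fun x _ => hvv₂ x), ← mul_sum] at h8
        omega) with h | h
      · exact h
      · exfalso
        have hcnt : (8 : ℤ) ≤ #(univ.filter fun x => Odd (v₂ x)) := by norm_num at h; exact_mod_cast (by omega)
        have hge := hXset (univ.filter fun x => Odd (v₂ x)) 4 (by norm_num) (fun x hx => by
          obtain ⟨k, hk⟩ := (mem_filter.1 hx).2; have := hvv₂ x; omega)
        linarith
    -- LEVEL 4: no wild point at all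
    have hv0 : ∀ x, v x = 0 := by
      intro x
      by_contra hx
      have h8 : 8 ≤ v x ∨ v x ≤ -8 := by obtain ⟨k, hk⟩ := hv8 x; have := hvv₂ x; omega
      have h1 := to12_excess _ _ 8 (hτ₀val x) (by norm_num) h8
      have h2 : X x ≤ ∑ y, X y := single_le_sum (fun y _ => hXnn y) (mem_univ x)
      simp only [X] at h2
      linarith
    -- hence `Σ τ² = 8192 ≠ 10240`
    have hT8192 : (∑ x, (u x - 4 * sZ (f x)) ^ 2 : ℤ) = 8192 := by
      rw [hTdec, hsumτ₀, hE512, sum_eq_zero (fun x _ => by simp only [X]; rw [hv0 x]; ring)]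
      norm_num
    omega
  · /- `#E = 768`: no excess at all, `τ = τ₀` exactly, and the partner is bent with dual `g` -/
    have hE : #E = 768 := by omega
    have hXsum0 : ∑ x, X x = 0 := by
      have : (∑ x, (u x - 4 * sZ (f x)) ^ 2 : ℤ) = 10240 + ∑ x, X x := by rw [hTdec, hsumτ₀, hE]; norm_num
      linarith
    have hX0 : ∀ x, X x = 0 := fun x => (sum_eq_zero_iff_of_nonneg fun y _ => hXnn y).1 hXsum0 x (mem_univ x)
    have hv0 : ∀ x, v x = 0 := by
      intro x
      by_contra hx
      have h1 : 1 ≤ v x ∨ v x ≤ -1 := by omega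
      have h2 := to12_excess _ _ 1 (hτ₀val x) le_rfl h1
      have h3 := hX0 x
      simp only [X] at h3
      linarith
    have hτ : ∀ x, ((u x : ℤ) : ℝ) - 4 * (sZ (f x) : ℝ) = (τ₀ x : ℝ) := by
      intro x
      have h := hvx x
      rw [hv0 x, mul_zero, add_zero] at h
      exact_mod_cast h
    -- the affine digit as a character: `(−1)^{d₁} = signOf b₁ · (−1)^{c₁·x}`
    obtain ⟨c₁, b₁, hcb⟩ := stub_affineForm (6 + 6) _ hd1
    have hsb : signOf b₁ = 1 ∨ signOf b₁ = -1 := by cases b₁ <;> simp [signOf]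
    -- the `E`-indicator as the support of the cubic `cE`
    set cE : (Fin (6 + 6) → Bool) → Bool := fun x => (decide (Odd (u x / 2)) ^^ decide (Odd (u x / 2 / 2))) ^^ true with hcEdef
    have hcE3 : IsDegLeFun 3 cE := hdegE
    have hcE768 : #(univ.filter fun x => cE x = true) = 768 := by rw [hsetE, hE]
    have hcEiff : ∀ x, cE x = true ↔ (Odd (u x / 2) ↔ Odd (u x / 2 / 2)) := by
      intro x; simp only [cE]; by_cases h1 : Odd (u x / 2) <;> by_cases h2 : Odd (u x / 2 / 2) <;> simp [h1, h2]
    -- `τ₀` in real form: `signOf b₁ · twist c₁ x · (1 − 4·[cE x])`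
    have hτ₀R : ∀ x, (τ₀ x : ℝ) = signOf b₁ * twist c₁ x * (1 - 4 * (if cE x = true then 1 else 0)) := by
      intro x
      simp only [τ₀]
      push_cast
      rw [tp_sZ_cast, hcb x]
      by_cases h : (Odd (u x / 2) ↔ Odd (u x / 2 / 2))
      · rw [if_pos h, if_pos ((hcEiff x).2 h)]
      · rw [if_neg h, if_neg (fun h' => h ((hcEiff x).1 h'))]
    -- Walsh inversion: `4 W_f(y) = 256 (−1)^{g(y)} − Σ_x τ₀(x) (−1)^{x·y}`
    have hinvg : ∀ y, ∑ x, (u x : ℝ) * twist x y = 256 * signOf (g y) := by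
      intro y
      have h := tz_inversion (fun y => signOf (g y)) y
      rw [sum_congr rfl fun x _ => by rw [hu x]] at h
      have h' : (2 : ℝ) ^ 4 * ∑ x, (u x : ℝ) * twist x y = 2 ^ (6 + 6) * signOf (g y) := by
        rw [mul_sum]; rw [← h]; exact sum_congr rfl fun x _ => by ring
      have e16 : (2 : ℝ) ^ (6 + 6) = 2 ^ 4 * 256 := by norm_num
      rw [e16, mul_assoc] at h'
      exact mul_left_cancel₀ (by positivity) h'
    have h4Wf : ∀ y, 4 * W (fun x => signOf (f x)) y = 256 * signOf (g y) - ∑ x, (τ₀ x : ℝ) * twist x y := by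
      intro y
      unfold W
      rw [mul_sum, ← hinvg y, ← sum_sub_distrib]
      refine sum_congr rfl fun x _ => ?_
      have h := hτ x
      rw [tp_sZ_cast] at h
      have : (4 : ℝ) * signOf (f x) = (u x : ℝ) - (τ₀ x : ℝ) := by linarith
      rw [show (4 : ℝ) * (signOf (f x) * twist x y) = (4 * signOf (f x)) * twist x y by ring, this]; ring
    -- the character sums: `Σ_x τ₀ twist = signOf b₁ (4096·[c₁ ⊕ y = 0] − 4 Σ_{E} twist x (c₁ ⊕ y))`
    have hτ₀sum : ∀ y, ∑ x, (τ₀ x : ℝ) * twist x y =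
        signOf b₁ * ((if bxor c₁ y = (fun _ => false) then (2 : ℝ) ^ (6 + 6) else 0) -
          4 * ∑ x ∈ univ.filter (fun x => cE x = true), twist x (bxor c₁ y)) := by
      intro y
      have e1 : ∀ x, (τ₀ x : ℝ) * twist x y = signOf b₁ * twist x (bxor c₁ y) -
          signOf b₁ * (4 * (if cE x = true then twist x (bxor c₁ y) else 0)) := by
        intro x
        rw [hτ₀R x, twist_bxor_right, twist_comm x c₁]; split_ifs <;> ring
      rw [sum_congr rfl fun x _ => e1 x, sum_sub_distrib, ← mul_sum, ← mul_sum, ← mul_sum, tz_sum_twist_left, ← sum_filter]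
      ring
    -- hence `W_f(y) = 64 (−1)^{g(y)} + 256 M(y)` with an integer `M(y)`
    have hWf : ∀ y, ∃ M : ℤ, W (fun x => signOf (f x)) y = 64 * signOf (g y) + 256 * (M : ℝ) := by
      intro y
      obtain ⟨m, hm⟩ := to15_char_sum_E cE hcE3 hcE768 (bxor c₁ y)
      have h := h4Wf y
      rw [hτ₀sum y, hm] at h
      by_cases h0 : bxor c₁ y = (fun _ => false)
      · rw [if_pos h0] at h
        rcases hsb with hs | hs <;> rw [hs] at h
        · exact ⟨m - 4, by push_cast; norm_num at h ⊢; linarith⟩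
        · exact ⟨-(m - 4), by push_cast; norm_num at h ⊢; linarith⟩
      · rw [if_neg h0] at h
        rcases hsb with hs | hs <;> rw [hs] at h
        · exact ⟨m, by norm_num at h ⊢; linarith⟩
        · exact ⟨-m, by push_cast; norm_num at h ⊢; linarith⟩
    choose M hM using hWf
    -- Parseval: `Σ_y W_f(y)² = 2²⁴`, and `W_f(y)² = 4096 (sZ(g y) + 4M)²` with an odd `sZ(g y) + 4M`
    have hPars : ∑ y, W (fun x => signOf (f x)) y ^ 2 = 4096 * 4096 := by
      rw [sum_W_sq, sum_congr rfl fun x _ => signOf_sq (f x), sum_const, card_univ, Fintype.card_fun, Fintype.card_bool,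
        Fintype.card_fin]
      norm_num
    have hsqy : ∀ y, W (fun x => signOf (f x)) y ^ 2 = 4096 * (((sZ (g y) + 4 * M y : ℤ) : ℝ)) ^ 2 := by
      intro y
      rw [hM y, ← tp_sZ_cast]; push_cast; ring
    have hsumsq : ∑ y, ((sZ (g y) + 4 * M y : ℤ) : ℝ) ^ 2 = 4096 := by
      have h := hPars
      rw [sum_congr rfl fun y _ => hsqy y, ← mul_sum] at h
      linarith
    have hsumsqZ : ∑ y, (sZ (g y) + 4 * M y) ^ 2 = (4096 : ℤ) := by exact_mod_cast hsumsq
    have hge1 : ∀ y, 1 ≤ (sZ (g y) + 4 * M y) ^ 2 := by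
      intro y
      have : sZ (g y) + 4 * M y ≤ -1 ∨ 1 ≤ sZ (g y) + 4 * M y := by rcases tp_sZ_cases (g y) with h | h <;> rw [h] <;> omega
      exact tp_sq_ge (k := 1) (by norm_num) this
    have hM0 : ∀ y, M y = 0 := by
      have hz : ∑ y, ((sZ (g y) + 4 * M y) ^ 2 - 1) = (0 : ℤ) := by
        rw [sum_sub_distrib, hsumsqZ, sum_const, card_univ, Fintype.card_fun, Fintype.card_bool, Fintype.card_fin]; norm_num
      intro y
      have h1 := (sum_eq_zero_iff_of_nonneg fun y _ => by linarith [hge1 y]).1 hz y (mem_univ y)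
      have h2 : (sZ (g y) + 4 * M y) * (sZ (g y) + 4 * M y) = 1 := by rw [← sq]; linarith
      rcases mul_self_eq_one_iff.1 h2 with h | h <;> rcases tp_sZ_cases (g y) with hs | hs <;> rw [hs] at h <;> omega
    -- so `W_f = 64 (−1)^g` and `Φ = 1`
    have hWf64 : ∀ y, W (fun x => signOf (f x)) y = 64 * signOf (g y) := fun y => by rw [hM y, hM0 y]; push_cast; ring
    have hΦ1 : forrelation f g = 1 := by
      rw [SgnForrMem.forrelation_eq_sum_W, sum_congr rfl fun y _ => by rw [hWf64 y]]
      have e : ∀ y : Fin (6 + 6) → Bool, signOf (g y) * (64 * signOf (g y)) = 64 := fun y => by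
        have := signOf_sq (g y); rw [sq] at this; linear_combination 64 * this
      rw [sum_congr rfl fun y _ => e y, sum_const, card_univ, Fintype.card_fun, Fintype.card_bool, Fintype.card_fin,
        show (2 : ℝ) ^ (3 * (6 + 6)) = (2 ^ 18) ^ 2 by norm_num, Real.sqrt_sq (by positivity)]
      norm_num
    rw [hΦ1] at hΦeq
    norm_num at hΦeq

end Summit.QuantumAdvantage.QuantumAdvantage.Theorems.CubicForrelation.NearExactIsExact

end
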